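import Summits.CriticalPhenomena.Ising3D.Control2DL15BoxPCells
import Summits.CriticalPhenomena.Ising3D.Control2DL15BoxPRegion
import Mathlib.Tactic.Linarith
import Mathlib.Tactic.NormNum
import HarnessLib

/-!
# A kind-`box` 2D γ-certificate in the kernel: `Δ_ε ∉ [3/10, 37/100]` at `Δ_σ = 1/8` under `A2D′` (Λ = 15)
(cell `pub-ising3x`, seat controls-1 gen 18; KERNEL PATH for the 2D γ-certificates, Λ = 15 box kind — CONTROL-ONLY)

HONEST FRAMING: lottery ticket; floor = tightest certified 3D Ising CFT bounds; no exact-solution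
claim without a proof. CONTROL-ONLY: `d = 2`, global blocks, `Δ_σ = 1/8` exact, the 2D axiom set `A2D′`
(scalars of `σ × σ` in the `ε` box `∪ [2, ∞)`, stress tensor at `(2,2)` + spin-2 gap `1`, unitarity) — this
validates the kind-`box` certificate PIPELINE of the class-1 2D control on the exactly solved 2D Ising model
(`Δ_ε = 1`); nothing about `d = 3`.

**`excludedOn_2d_L15_boxP : ExcludedOn (1/8) 2 1 (Icc (3 / 10) (37 / 100))`** from the RB-2 certificate `j129649_functional_deriv2d_L15_E040_sig1o8_box0.30-0.37.json` (Λ = 15, E₀ = 40): Δ_ε ∉ [3/10, 37/100] at Δ_σ = 1/8 under A2D′,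
with EVERY obligation re-decided in the Lean kernel: (I) `ident_boxP`, (R) `region_boxP` (`Control2DRegionKernelAuto`:
per-`J` shapes + compactified large-`S` tensor shape, Bernstein coefficients computed in the kernel), cells `cells_boxP` (one integer polynomial
per spin from the literal library, Bernstein leaves). Zero grant compute. No facts, standard axioms only.
-/

namespace Summit.CriticalPhenomena.Ising3D.Control2D

open Finset Set
open Literature.MathematicalPhysics.QuantumFieldTheory.ConformalBootstrap3D

/-- **2D control, γ-architecture, kind `box`, kernel-complete: under `A2D′` at `Δ_σ = 1/8` no `ε` location in
`[3/10, 37/100]` is possible**, every obligation of the Λ = 15 functional checked in the Lean kernel. CONTROL-ONLY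
(d = 2). [cite: RattazziEtAl2008, §5.5] -/
theorem excludedOn_2d_L15_boxP : ExcludedOn (1 / 8 : ℝ) 2 1 (Icc (3 / 10 : ℝ) (37 / 100)) :=
  excludedOn_half_of_cellsN slL15.toFinset (fun p => (wtboxP p : ℝ)) (by norm_num) (by norm_num) (by norm_num)
    (by norm_num) (by norm_num) ident_boxP (fun b J hb hE => region_boxP b J hb hE) cells_boxP

/-- **The same as a `BoxExcluded` statement** (the box lies above `2Δ_σ = 1/4`). [cite: RattazziEtAl2008, §5.5] -/
theorem boxExcluded_2d_L15_boxP : BoxExcluded (1 / 8 : ℝ) 2 1 (3 / 10) (37 / 100) :=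
  boxExcluded_half_of_cellsN slL15.toFinset (fun p => (wtboxP p : ℝ)) (by norm_num) (by norm_num) (by norm_num)
    (by norm_num) (by norm_num) (by norm_num) ident_boxP (fun b J hb hE => region_boxP b J hb hE) cells_boxP

end Summit.CriticalPhenomena.Ising3D.Control2D
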